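import Summits.Ventures.DiscreteObjects.UnitDistance.FiniteFieldLowerBoundF19Data
import HarnessLib

/-!
# `UD(F₁₉²)` is not 4-colourable — kernel search, piece 12 of 12 (the subtree below `ud19Q12`)

Framing (verbatim for the cell): lottery ticket; floor = certified bounds/negative ranges.

The subtree of the colouring search (`KernelColouringSearch.lean`: bit-vector states, unit propagation, PASS branching) below the depth-3
state `ud19Q12` of `FiniteFieldLowerBoundF19Data.lean`, cut once more into 2 sub-states `ud19R12x1, ud19R12x2` (depth 4–5, each ≤ 0.7·10⁶
bit-vector operations so that one kernel evaluation stays within memory): each sub-state is refuted by `decide +kernel`, then `ud19Q12` is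
refuted by the search with those sub-states as its `done` list, and `ud19_piece12` packages the logical statement used by
`FiniteFieldLowerBoundF19.lean`: no proper 4-colouring is consistent with `ud19Q12`.
-/

namespace Summit.Ventures.DiscreteObjects.UnitDistance

open KBits

/-- Search state after the branches `1 ↦ 2 → 20 ↦ 3 → 42 ↦ 3 → 43 ↦ 0` (vertex ↦ colour, each followed by unit propagation). -/
def ud19R12x1 : ℕ × ℕ × ℕ × ℕ × ℕ :=
  (3486108374792256527112909043844843867576087711811229199851314252052028780407728478138714586630758235393752573,
   4403373926853891900541762632794754289747465968727507224813109067065324460829371943835350238159908609725562878,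
   4697066127170269904871784160498556399593056094886086664585594760238112418547241983584845737531273783145922554,
   4091314698070219825670702404611283101789426034595387674314071884149664900717928633069866402000480452189093628,
   4697085165547666455778961193578674054751365097816639741414581943064418050229216886927397996769524211922763772)

/-- Search state after the branches `1 ↦ 2 → 20 ↦ 3 → 42 ↦ 3 → 43 ↦ 1` (vertex ↦ colour, each followed by unit propagation). -/
def ud19R12x2 : ℕ × ℕ × ℕ × ℕ × ℕ :=
  (4697075646358968180325372677038615227172210596351363203000088351651265234388229435256121867150405594604896253,
   3192406657474430972112310923973485157268964449540542652557547403891858613264016282775853708492300525820182012,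
   4697066127170269904871784160498556399593056094886086664585594760238112418547241983584845737531273783145922554,
   4091314698070219825670702404611283101789426034595387674314071884149664900717928633069866402000480452189093628,
   4697085165547666455778961193578674054751365097816639741414581943064418050229216886927397996769524211922763772)

set_option maxHeartbeats 400000000 in
set_option maxRecDepth 200000 in
/-- KERNEL FACT: the search refutes every 4-colouring below `ud19R12x1`. -/
theorem ud19R12x1_run : search ud19nb 361 40 [] 361 ud19R12x1 = true := by
  decide +kernel

set_option maxHeartbeats 400000000 in
set_option maxRecDepth 200000 in
/-- KERNEL FACT: the search refutes every 4-colouring below `ud19R12x2`. -/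
theorem ud19R12x2_run : search ud19nb 361 40 [] 361 ud19R12x2 = true := by
  decide +kernel

set_option maxHeartbeats 400000000 in
set_option maxRecDepth 200000 in
/-- KERNEL FACT: below `ud19Q12` every branch dies or reaches one of the refuted sub-states. -/
theorem ud19Q12_run : search ud19nb 361 40 [ud19R12x1, ud19R12x2] 361 ud19Q12 = true := by
  decide +kernel

/-- PIECE 12: no proper 4-colouring (for the neighbourhood words `ud19nb`) is consistent with the state `ud19Q12`. -/
theorem ud19_piece12 {col : ℕ → ℕ} (hP : Proper ud19nb 361 col) :
    UBound 361 ud19Q12 → Cons 361 col ud19Q12 → False := by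
  refine search_sound hP (done := [ud19R12x1, ud19R12x2]) ?_ 361 _ ud19Q12_run
  intro d hd
  simp only [List.mem_cons, List.not_mem_nil, or_false] at hd
  rcases hd with rfl | rfl
  · exact search_sound hP (done := []) (by simp) 361 _ ud19R12x1_run
  · exact search_sound hP (done := []) (by simp) 361 _ ud19R12x2_run

end Summit.Ventures.DiscreteObjects.UnitDistance
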